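import Summits.AtomisticToContinuum.Crystallization.Theorems.FrustratedLawDichotomyStrainedPatchRecutKinematics

/-!
# Window-honest families: the RIM CRACK of the bent families and its repair (lens-5 g54, file W)

Crux 27623 (T-side), node [CORE-FAR].  THE RIM CRACK (found while typing (RFᴿ-bent₁)'s instance half, NODE-g54 §9; census `rimcrack54_{id,strained}.json`):
the typed families cut the WINDOW in SKELETON space — `IsBentBall 𝓑 (133/10) z₁ c₁` says the unbent skeleton `z₀` has `Set.range z₀ =` the EXACT lattice
ball of radius `133/10` (`IsHomBall`) — but bound the BENT radius by the same number: `Admissible` (hence the chart family `bentFamily 𝓑₀ η` of (F2-bent₀))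
and `compFamily` (hence `𝓘₁⁺ = CompFamily1` of (T2/MEM/LIN/DOM/F3-bent₁)) both carry the clause `∀ a, dist (z a) (z c) ≤ 133/10`.  For a genuinely bent
instance (`b v = v + Q(v,v) + C(v,v,v)`, `Q ≠ 0`) the two clauses COLLIDE at the rim: the radial quadratic form `⟨v̂, Q(v,v)⟩` is ODD in `v`, so half of the
rim directions are pushed outward, and a lattice ball of radius `13.3` has `≈ 270` skeleton points within `0.1` of the rim (generic strained skeleton: largest
norm within `1.7·10⁻⁴` of `13.3`).  Census (fcc, nn `1`, skeleton matrix `‖G₀ − 1‖ ≈ 0.06`): a chart with `|Q| = 10⁻⁵` already has a site at bent radius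
`> 13.3` (excess `2·10⁻⁴…1.2·10⁻³`); `|Q| = 10⁻⁴`: `3–5` violators; `|Q| = 10⁻³` (the curvature a far host needs a bend for: push `0.04 > T₀` at radius `6.3`):
`33–63` violators, excess `0.06–0.14`; repairing by an inward cubic `−γ‖v‖²v` costs `γ·6.3³ = 0.006…0.016` of fine accuracy at radius `6.3` (`T₀ ≤ 1/60`).
The RECUT by `T = 1 + A`, `‖A‖ = 1/150`, of a bent chart has `2–6` (`|Q| = 10⁻⁴`) / `25–32` (`|Q| = 10⁻³`) sites violating the comparison family's clause — and
ZERO at radius `16`; of an UNBENT chart (`b₀ = id`): zero (the clause is then the window itself).  CONSEQUENCES AS TYPED: (i) a bent instance satisfies the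
radius clause only if its bend pulls every near-rim skeleton point inward — (F2-bent₀)'s chooser (an `∃`) can realise bent charts only with an inward-cubic
discipline paid from the fine budget, and (RF-bent₁)/(RFᴿ-bent₁)'s recut image (an `∃`) is in `𝓘₁⁺` only under the same discipline with margin; (ii) NOTHING on
the `∀` side uses the clause: the (T2-bent₁) proof (g53 E–J + `…TaylorSplit/Pair`) projects `CompFamily1` only to `.1` (injective), `.2.1` (`Sep`), `.2.2.2.1`
(`IsBentBall`) and the chart's covering clause; scores, fit levels, `windowRoom`, membership columns and the census tables see sites within `63/10` only.

THE REPAIR TYPED HERE (option W′ of NODE-g54 §10, recommended; the critic rules): WINDOW-HONEST families with the bent-radius clause RELAXED to `16` — a bound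
that FOLLOWS from `IsBentBall 𝓑₁ (133/10)` (§1: `‖b v‖ ≤ ‖v‖ + q₂‖v‖² + q₃‖v‖³ ≤ 15.57`), kept as a conjunct IN THE SAME POSITION so that every existing proof
over `CompFamily1` re-runs by renaming:
* §1 `norm_polyBend_le`, `norm_bends1_le_sixteen`, ★ `dist_le_sixteen_of_isBentBall` (the relaxed clause is automatic), `norm_recut_le_sixteen`;
* §2 `AdmissibleW` (= `Admissible` with radius `16`), `bentFamilyW`, `compFamilyW`, `CompFamilyW := compFamilyW 𝓑₁ (7/100)`, the inclusions
  `bentFamily ≤ bentFamilyW ≤ compFamilyW`, `CompFamily1 ≤ CompFamilyW`, ★ `compFamilyW_of_sepBent` (membership WITHOUT a radius check);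
* §3 antitonicity of (T2) (MEM) (BAS) (LIN) in the comparison family; ★ `TaylorTwoBentW := SmoothTaylorTwo CompFamilyW (7/20) (1/20) G₀ w₀ ϱ₀` — OPEN here, closed by
  re-running `…TaylorSplit/…TaylorPair/…TaylorTail/…TaylorCap/…TaylorClose` with `CompFamily1 ↦ CompFamilyW` (the projections used are position-stable); it
  implies (T2-bent₁) (`taylorTwoBent1_of_W`).
The pinned record over these families is `…StrainedPatchRecutRecord` §B.  No sorry, no new axioms, no cite tokens, no instances / notation.
-/

namespace Summit.AtomisticToContinuum.Crystallization.Theorems.FrustratedLawDichotomyStrainedPatchWindowFamilies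


open scoped BigOperators Classical
open Summit.AtomisticToContinuum.Crystallization.Theorems.FrustratedLawDichotomyPeriodicBlockFlags (goodAtScale_mono)
open Summit.AtomisticToContinuum.Crystallization.Theorems.FrustratedLawDichotomyRangeCut (Sep)
open Summit.AtomisticToContinuum.Crystallization.Theorems.FrustratedLawDichotomyMotifLemmas
open Summit.AtomisticToContinuum.Crystallization.Theorems.FrustratedLawDichotomyAveragingCut
open Summit.AtomisticToContinuum.Crystallization.Theorems.FrustratedLawDichotomyAveragingRuleCap
open Summit.AtomisticToContinuum.Crystallization.Theorems.FrustratedLawDichotomyAveragingRuleTightFree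
open Summit.AtomisticToContinuum.Crystallization.Theorems.FrustratedLawDichotomyExemptDoor (SitePred)
open Summit.AtomisticToContinuum.Crystallization.Theorems.FrustratedLawDichotomyExemptAbsorption
open Summit.AtomisticToContinuum.Crystallization.Theorems.FrustratedLawDichotomyExemptAbsorptionRecord
open Summit.AtomisticToContinuum.Crystallization.Theorems.FrustratedLawDichotomyCollarCensus
open Summit.AtomisticToContinuum.Crystallization.Theorems.FrustratedLawDichotomyCollarCensusKappa
open Summit.AtomisticToContinuum.Crystallization.Theorems.FrustratedLawDichotomyStrainedPatchHomSplit
open Summit.AtomisticToContinuum.Crystallization.Theorems.FrustratedLawDichotomyStrainedPatchCleanCollar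
open Summit.AtomisticToContinuum.Crystallization.Theorems.FrustratedLawDichotomyStrainedPatchHomTube
open Summit.AtomisticToContinuum.Crystallization.Theorems.FrustratedLawDichotomyStrainedPatchHomIsometry
open Summit.AtomisticToContinuum.Crystallization.Theorems.FrustratedLawDichotomyStrainedPatchHomTubeIso
open Summit.AtomisticToContinuum.Crystallization.Theorems.FrustratedLawDichotomyStrainedPatchPhaseCut
open Summit.AtomisticToContinuum.Crystallization.Theorems.FrustratedLawDichotomyStrainedPatchCoreTube
open Summit.AtomisticToContinuum.Crystallization.Theorems.FrustratedLawDichotomyStrainedPatchCoreTubeRecord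
open Summit.AtomisticToContinuum.Crystallization.Theorems.FrustratedLawDichotomyStrainedPatchCoreTubeMilli
open Summit.AtomisticToContinuum.Crystallization.Theorems.FrustratedLawDichotomyStrainedPatchStrainBands
open Summit.AtomisticToContinuum.Crystallization.Theorems.FrustratedLawDichotomyStrainedPatchChartFamilies
open Summit.AtomisticToContinuum.Crystallization.Theorems.FrustratedLawDichotomyStrainedPatchChartFamiliesBent
open Summit.AtomisticToContinuum.Crystallization.Theorems.FrustratedLawDichotomyStrainedPatchChartFamiliesPinned
open Summit.AtomisticToContinuum.Crystallization.Theorems.FrustratedLawDichotomyStrainedPatchEnvelopeLaw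
open Summit.AtomisticToContinuum.Crystallization.Theorems.FrustratedLawDichotomyStrainedPatchEnvelopeTaylor
open Literature.Barriers.AtomisticToContinuum.FlatleyTheil2015 (fccVec)
open Summit.AtomisticToContinuum.Crystallization.Theorems.FrustratedLawDichotomyStrainedPatchRecutPairs
open Summit.AtomisticToContinuum.Crystallization.Theorems.FrustratedLawDichotomyStrainedPatchRecutKinematics

/-! ## §1. The bent radius of a bent `133/10`-ball is at most `16` -/

/-- `‖b v‖ ≤ ‖v‖ + q₂‖v‖² + q₃‖v‖³` for a polynomial bend. [formal bookkeeping] -/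
theorem norm_polyBend_le {q₂ q₃ : ℝ} {b : E3 → E3} (hb : b ∈ polyBends q₂ q₃) (v : E3) : ‖b v‖ ≤ ‖v‖ + q₂ * ‖v‖ ^ 2 + q₃ * ‖v‖ ^ 3 := by
  obtain ⟨Q, C, hQ, hC, hb⟩ := hb
  rw [hb v]
  have h1 : ‖Q v v‖ ≤ q₂ * ‖v‖ ^ 2 := by rw [sq, ← mul_assoc]; exact hQ v v
  have h2 : ‖C v v v‖ ≤ q₃ * ‖v‖ ^ 3 := by
    calc ‖C v v v‖ ≤ q₃ * ‖v‖ * ‖v‖ * ‖v‖ := hC v v v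
      _ = q₃ * ‖v‖ ^ 3 := by ring
  calc ‖v + Q v v + C v v v‖ ≤ ‖v‖ + ‖Q v v‖ + ‖C v v v‖ := norm_add₃_le
    _ ≤ ‖v‖ + q₂ * ‖v‖ ^ 2 + q₃ * ‖v‖ ^ 3 := by linarith

/-- ★ A `𝓑₁`-bent image of a skeleton vector of norm `≤ 133/10` has norm `≤ 16` (`13.3 + (11/2000)·13.3² + (11/20000)·13.3³ = 15.567`). [formal bookkeeping] -/
theorem norm_bends1_le_sixteen {b : E3 → E3} (hb : b ∈ bends1) {v : E3} (hv : ‖v‖ ≤ 133 / 10) : ‖b v‖ ≤ 16 := by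
  have h := norm_polyBend_le (q₂ := 11 / 2000) (q₃ := 11 / 20000) (by simpa [bends1] using hb) v
  have h0 : 0 ≤ ‖v‖ := norm_nonneg v
  have h2 : ‖v‖ ^ 2 ≤ (133 / 10) ^ 2 := pow_le_pow_left₀ h0 hv 2
  have h3 : ‖v‖ ^ 3 ≤ (133 / 10) ^ 3 := pow_le_pow_left₀ h0 hv 3
  nlinarith

/-- ★ **The relaxed radius clause is AUTOMATIC**: every site of a `𝓑`-bent `133/10`-ball (`𝓑 ⊆ 𝓑₁`) is within `16` of the centre. [folklore] -/
theorem dist_le_sixteen_of_isBentBall {𝓑 : Set (E3 → E3)} (h𝓑 : 𝓑 ⊆ bends1) {M₁ : ℕ} {z₁ : Fin M₁ → E3} {c₁ : Fin M₁} (h : IsBentBall 𝓑 (133 / 10) z₁ c₁)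
    (a : Fin M₁) : dist (z₁ a) (z₁ c₁) ≤ 16 := by
  obtain ⟨b, z₀, hb, hH, hz⟩ := h
  have hza : dist (z₀ a) (z₀ c₁) ≤ 133 / 10 := by
    obtain ⟨G, ξ, -, -, hr⟩ := hH
    have hmem : z₀ a ∈ Set.range z₀ := ⟨a, rfl⟩
    rcases hr with hr | hr
    · rw [hr] at hmem; exact hmem.1
    · rw [hr] at hmem; exact hmem.1
  rw [dist_eq_norm, hz a]
  exact norm_bends1_le_sixteen (h𝓑 hb) (by rwa [dist_eq_norm] at hza)

/-- ★ The RECUT's bent radius: for a `𝓑₀`-bent chart vector `v` entering the re-cut window (`‖(1+A) v‖ ≤ 133/10`, `‖A‖ ≤ 1/150`) the recut position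
`(1+A)(b₀ v)` is within `16` (it is `b₁ ((1+A) v)` for the conjugate `b₁ ∈ 𝓑₁`). [folklore] -/
theorem norm_recut_le_sixteen {b₀ : E3 → E3} (hb : b₀ ∈ bends0) (A : E3 →L[ℝ] E3) (hA : ‖A‖ ≤ 1 / 150) {v : E3}
    (hv : ‖((1 : E3 →L[ℝ] E3) + A) v‖ ≤ 133 / 10) : ‖((1 : E3 →L[ℝ] E3) + A) (b₀ v)‖ ≤ 16 := by
  obtain ⟨b₁, hb₁, hconj⟩ := exists_conj_bends1 hb A hA
  rw [← hconj v]
  exact norm_bends1_le_sixteen hb₁ hv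

/-! ## §2. The window-honest families -/

/-- **`AdmissibleW`** — `Admissible` with the bent-radius clause relaxed to `16` (injective, `7/10`-separated, within `16` of the centre, no tight / exempt /
bad caps near the `9/5`-core).  For CHARTS and COMPARISON INSTANCES only — hosts stay `Admissible`. -/
def AdmissibleW (M : ℕ) (z : Fin M → E3) (c : Fin M) : Prop :=
  Function.Injective z ∧ Sep z ∧ (∀ a : Fin M, dist (z a) (z c) ≤ 16) ∧
    ¬TightNearCap (9 / 5) (3 / 2) z c ∧ ¬ExemptNear (9 / 5) ExRec z c ∧ ¬BadNearCap (9 / 5) (3 / 2) z c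

/-- `Admissible ⟹ AdmissibleW`. [formal bookkeeping] -/
theorem admissibleW_of_admissible {M : ℕ} {z : Fin M → E3} {c : Fin M} (h : Admissible M z c) : AdmissibleW M z c :=
  ⟨h.1, h.2.1, fun a => (h.2.2.1 a).trans (by norm_num), h.2.2.2⟩

/-- **`bentFamilyW 𝓑 η₃`** — the window-honest BENT CHART FAMILY: `AdmissibleW` bent `133/10`-balls with an `η₃`-good centre (same conjunct positions as `bentFamily`). -/
def bentFamilyW (𝓑 : Set (E3 → E3)) (η₃ : ℝ) : (M₀ : ℕ) → (Fin M₀ → E3) → Fin M₀ → Prop :=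
  fun M₀ z₁ c₁ => AdmissibleW M₀ z₁ c₁ ∧ IsBentBall 𝓑 (133 / 10) z₁ c₁ ∧ GoodAtScale η₃ (3 / 2) z₁ c₁

/-- **`compFamilyW 𝓑 η₃`** — the window-honest COMPARISON FAMILY: `compFamily` with the radius clause relaxed to `16` (same conjunct positions). -/
def compFamilyW (𝓑 : Set (E3 → E3)) (η₃ : ℝ) : (M₁ : ℕ) → (Fin M₁ → E3) → Fin M₁ → Prop :=
  fun _ z₁ c₁ => Function.Injective z₁ ∧ Sep z₁ ∧ (∀ a, dist (z₁ a) (z₁ c₁) ≤ 16) ∧ IsBentBall 𝓑 (133 / 10) z₁ c₁ ∧ GoodAtScale η₃ (3 / 2) z₁ c₁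

/-- ★ **`𝓘₁ʷ := compFamilyW 𝓑₁ (7/100)`** — the window-honest comparison family of record. -/
def CompFamilyW : (M₁ : ℕ) → (Fin M₁ → E3) → Fin M₁ → Prop := compFamilyW bends1 eta30

/-- `bentFamily ≤ bentFamilyW`. [formal bookkeeping] -/
theorem bentFamily_le_W (𝓑 : Set (E3 → E3)) (η₃ : ℝ) : FamilyLE (bentFamily 𝓑 η₃) (bentFamilyW 𝓑 η₃) :=
  fun _ _ _ h => ⟨admissibleW_of_admissible h.1, h.2⟩

/-- `compFamily ≤ compFamilyW`. [formal bookkeeping] -/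
theorem compFamily_le_W (𝓑 : Set (E3 → E3)) (η₃ : ℝ) : FamilyLE (compFamily 𝓑 η₃) (compFamilyW 𝓑 η₃) :=
  fun _ _ _ h => ⟨h.1, h.2.1, fun a => (h.2.2.1 a).trans (by norm_num), h.2.2.2⟩

/-- `𝓘₁⁺ ≤ 𝓘₁ʷ`. [formal bookkeeping] -/
theorem compFamily1_le_W : FamilyLE CompFamily1 CompFamilyW := compFamily_le_W bends1 eta30

/-- `bentFamilyW 𝓑 η₃ ≤ compFamilyW 𝓑' η₃'` for `𝓑 ⊆ 𝓑'`, `η₃ ≤ η₃'`. [formal bookkeeping] -/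
theorem bentFamilyW_le_compFamilyW {𝓑 𝓑' : Set (E3 → E3)} (hB : 𝓑 ⊆ 𝓑') {η₃ η₃' : ℝ} (hle : η₃ ≤ η₃') : FamilyLE (bentFamilyW 𝓑 η₃) (compFamilyW 𝓑' η₃') := by
  rintro M₀ z₁ c₁ ⟨hz, ⟨b, z₀, hb, hhom, hab⟩, hg⟩
  exact ⟨hz.1, hz.2.1, hz.2.2.1, ⟨b, z₀, hB hb, hhom, hab⟩, goodAtScale_mono hle hg⟩

/-- ★★ **Membership in `compFamilyW` WITHOUT a radius check** (`𝓑 ⊆ 𝓑₁`): injective + separated + a `𝓑`-bent `133/10`-ball + an `η₃`-good centre.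
This is what (RFᴿ)'s recut construction has to deliver — the rim plays no role. [folklore] -/
theorem compFamilyW_of_sepBent {𝓑 : Set (E3 → E3)} (h𝓑 : 𝓑 ⊆ bends1) {η₃ : ℝ} {M₁ : ℕ} {z₁ : Fin M₁ → E3} {c₁ : Fin M₁} (hinj : Function.Injective z₁)
    (hsep : Sep z₁) (hbent : IsBentBall 𝓑 (133 / 10) z₁ c₁) (hgood : GoodAtScale η₃ (3 / 2) z₁ c₁) : compFamilyW 𝓑 η₃ M₁ z₁ c₁ :=
  ⟨hinj, hsep, dist_le_sixteen_of_isBentBall h𝓑 hbent, hbent, hgood⟩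

/-- … and in `bentFamilyW` without a radius check (`𝓑 ⊆ 𝓑₁`). [folklore] -/
theorem bentFamilyW_of_sepBent {𝓑 : Set (E3 → E3)} (h𝓑 : 𝓑 ⊆ bends1) {η₃ : ℝ} {M₀ : ℕ} {z₀ : Fin M₀ → E3} {c₀ : Fin M₀} (hinj : Function.Injective z₀)
    (hsep : Sep z₀) (hT : ¬TightNearCap (9 / 5) (3 / 2) z₀ c₀) (hX : ¬ExemptNear (9 / 5) ExRec z₀ c₀) (hBd : ¬BadNearCap (9 / 5) (3 / 2) z₀ c₀)
    (hbent : IsBentBall 𝓑 (133 / 10) z₀ c₀) (hgood : GoodAtScale η₃ (3 / 2) z₀ c₀) : bentFamilyW 𝓑 η₃ M₀ z₀ c₀ :=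
  ⟨⟨hinj, hsep, dist_le_sixteen_of_isBentBall h𝓑 hbent, hT, hX, hBd⟩, hbent, hgood⟩

/-! ## §3. Antitonicity in the comparison family; (T2ʷ) -/

/-- (T2) is antitone in the comparison family. [formal bookkeeping] -/
theorem smoothTaylorTwo_anti {𝓘 𝓘' : (M₀ : ℕ) → (Fin M₀ → E3) → Fin M₀ → Prop} (hle : FamilyLE 𝓘 𝓘') {τ δ : ℝ}
    {G : (M₁ : ℕ) → (Fin M₁ → E3) → Fin M₁ → Fin M₁ → (E3 →L[ℝ] ℝ)} {w : (M₁ : ℕ) → (Fin M₁ → E3) → Fin M₁ → Fin M₁ → Fin M₁ → ℝ}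
    {ϱ : (M₁ : ℕ) → (Fin M₁ → E3) → Fin M₁ → ℝ} (h : SmoothTaylorTwo 𝓘' τ δ G w ϱ) : SmoothTaylorTwo 𝓘 τ δ G w ϱ :=
  fun M z c M₁ z₁ c₁ e t hz hch hf => h M z c M₁ z₁ c₁ e t hz (hch.mono_family hle) hf

/-- (MEM) is antitone in the comparison family. [formal bookkeeping] -/
theorem membershipColumn_anti {𝓘 𝓘' : (M₀ : ℕ) → (Fin M₀ → E3) → Fin M₀ → Prop} (hle : FamilyLE 𝓘 𝓘') {τ δ : ℝ}
    {μ : (M₁ : ℕ) → (Fin M₁ → E3) → Fin M₁ → ℝ} (h : MembershipColumn 𝓘' τ δ μ) : MembershipColumn 𝓘 τ δ μ :=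
  fun M z c M₁ z₁ c₁ e t hz hcl hch hf => h M z c M₁ z₁ c₁ e t hz hcl (hch.mono_family hle) hf

/-- (BAS) is antitone in the comparison family. [formal bookkeeping] -/
theorem interiorBasin_anti {𝓘 𝓘' : (M₀ : ℕ) → (Fin M₀ → E3) → Fin M₀ → Prop} (hle : FamilyLE 𝓘 𝓘') {τ κA tmax δ : ℝ} (h : InteriorBasin 𝓘' τ κA tmax δ) :
    InteriorBasin 𝓘 τ κA tmax δ :=
  fun M z c M₁ z₁ c₁ e t hz hcl hmo ht ht' hch => h M z c M₁ z₁ c₁ e t hz hcl hmo ht ht' (hch.mono_family hle)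

/-- (LIN) is antitone in the comparison family. [formal bookkeeping] -/
theorem slavedFirstOrder_anti {P : (M : ℕ) → (Fin M → E3) → Fin M → (M₁ : ℕ) → (Fin M₁ → E3) → Fin M₁ → (Fin M → Fin M₁) → ℝ → Prop}
    {𝓘 𝓘' : (M₀ : ℕ) → (Fin M₀ → E3) → Fin M₀ → Prop} (hle : FamilyLE 𝓘 𝓘') {τ κA tmax δ : ℝ}
    {G : (M₁ : ℕ) → (Fin M₁ → E3) → Fin M₁ → Fin M₁ → (E3 →L[ℝ] ℝ)} {w : (M₁ : ℕ) → (Fin M₁ → E3) → Fin M₁ → Fin M₁ → Fin M₁ → ℝ}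
    {Ψ : (M₁ : ℕ) → (Fin M₁ → E3) → Fin M₁ → ℝ → ℝ} (h : SlavedFirstOrder P 𝓘' τ κA tmax δ G w Ψ) : SlavedFirstOrder P 𝓘 τ κA tmax δ G w Ψ :=
  fun M z c M₁ z₁ c₁ e t hz hcl hmo ht ht' hch hP hf => h M z c M₁ z₁ c₁ e t hz hcl hmo ht ht' (hch.mono_family hle) hP hf

/-- ★ **(T2ʷ)** `:= SmoothTaylorTwo 𝓘₁ʷ (7/20) (1/20) G₀ w₀ ϱ₀` — the second-order remainder lemma over the window-honest comparison family.  OPEN in this file;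
it is the g53 (T2-bent₁) proof re-run with `CompFamily1 ↦ CompFamilyW` (that proof uses the family only through `.1`, `.2.1`, `.2.2.2.1` and the chart's
covering clause — never the radius clause `.2.2.1`, never the good centre `.2.2.2.2`). -/
def TaylorTwoBentW : Prop := SmoothTaylorTwo CompFamilyW tau1 delta0 G0 w0 rho0

/-- (T2ʷ) ⟹ (T2-bent₁). [formal bookkeeping] -/
theorem taylorTwoBent1_of_W (h : TaylorTwoBentW) : TaylorTwoBent1 := smoothTaylorTwo_anti compFamily1_le_W h

end Summit.AtomisticToContinuum.Crystallization.Theorems.FrustratedLawDichotomyStrainedPatchWindowFamilies
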